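import Mathlib
import Literature.NumberTheory.GaloisRepresentations.CubicReciprocityRationalPrime
import Summits.Langlands.Langlands.Theorems.PicardMuOrdinaryResidualAutomorphyEvenTower

/-!
# From the hypotheses of `ResidualAutomorphyEven` to the cubic resolvent tower (Stage A0)

Helper file for item stmt-Langlands-13760 (route `PicardMuOrdinary`).  The route decl quantifies over
`f : ℤ[X]` with `f.natDegree = 4`, `(f ⊗ ℚ).Separable`, `12 ∣ #Gal(f ⊗ ℚ)` and `#roots(f ⊗ ℝ) = 4`
(four real roots).  The tower file works over `K = ℚ(ω)` with the hypotheses `IsSepQuartic f`,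
`12 ∣ #Gal(M/K)` and `a₄ ≠ 0`; this file derives them:

* `isSepQuartic_of_hyp`, `leadingCoeff_ne_zero_of_hyp` (bookkeeping);
* `twelve_dvd_card_G_of_hyp`: **`12 ∣ [M : K]`**.  The splitting field `L` of `f` over `ℚ` is real
  (four real roots), so `ω ∉ L` and the copy `L' ⊆ M = L·K` of `L` has `[M : L'] ≥ 2`; with
  `[M : ℚ] = 2 [M : K]` this gives `[M : K] ≥ [L : ℚ] ≥ 12`, and `[M : K] ∣ 24` (`card_G_dvd`) leaves
  `[M : K] ∈ {12, 24}`.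
-/

set_option linter.dupNamespace false -- project-wide option (lakefile weak.linter.dupNamespace); `Summit.Langlands.Langlands` is the mandated namespace

noncomputable section

namespace Summit.Langlands.Langlands.Theorems.ResidualAutomorphyEven

open Polynomial

variable {f : ℤ[X]}

/-- `algebraMap ℤ K` factors through `ℚ`. -/
theorem algebraMap_int_K : algebraMap ℤ K = (algebraMap ℚ K).comp (Int.castRingHom ℚ) :=
  RingHom.ext_int _ _

/-- `f ⊗ K = (f ⊗ ℚ) ⊗ K`. -/
theorem fK_eq_map_map (f : ℤ[X]) : fK f = (f.map (Int.castRingHom ℚ)).map (algebraMap ℚ K) := by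
  rw [fK, map_map, ← algebraMap_int_K]

/-- The tower hypothesis `IsSepQuartic f` from `natDegree f = 4` and separability of `f ⊗ ℚ`. -/
def isSepQuartic_of_hyp (hdeg : f.natDegree = 4) (hsep : (f.map (Int.castRingHom ℚ)).Separable) :
    IsSepQuartic f := by
  refine ⟨?_, ?_⟩
  · rw [fK, natDegree_map_eq_of_injective (algebraMap ℤ K).injective_int, hdeg]
  · rw [fK_eq_map_map]; exact hsep.map

/-- `a₄ ≠ 0`. -/
theorem leadingCoeff_ne_zero_of_hyp (hdeg : f.natDegree = 4) : f.leadingCoeff ≠ 0 := by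
  rw [Ne, leadingCoeff_eq_zero]; rintro rfl; simp at hdeg

/-- A primitive cube root of unity `ω ∈ K`, and its image in `M`: `ω² + ω + 1 = 0`. -/
theorem exists_omega_M (f : ℤ[X]) : ∃ z : M f, z ^ 2 + z + 1 = 0 := by
  haveI : IsCyclotomicExtension {3} ℚ (CyclotomicField 3 ℚ) := CyclotomicField.isCyclotomicExtension 3 ℚ
  obtain ⟨ζ, hζ⟩ := IsCyclotomicExtension.exists_isPrimitiveRoot ℚ (CyclotomicField 3 ℚ)
    (Set.mem_singleton (3 : ℕ)) (by norm_num)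
  refine ⟨algebraMap K (M f) ζ, ?_⟩
  have h := hζ.pow_eq_one
  have h1 : ζ ≠ 1 := hζ.ne_one (by norm_num)
  have : (ζ - 1) * (ζ ^ 2 + ζ + 1) = 0 := by ring_nf; linear_combination h
  have h2 : ζ ^ 2 + ζ + 1 = 0 := (mul_eq_zero.mp this).resolve_left (sub_ne_zero.mpr h1)
  have := congrArg (algebraMap K (M f)) h2
  simpa using this

/-- No real number satisfies `x² + x + 1 = 0`. -/
theorem real_sq_add_self_add_one_ne_zero (x : ℝ) : x ^ 2 + x + 1 ≠ 0 := by nlinarith [sq_nonneg (2 * x + 1)]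

/-- **`12 ∣ #Gal(M/K)`** from the hypotheses of the route decl (see the module docstring). -/
theorem twelve_dvd_card_G_of_hyp (hdeg : f.natDegree = 4) (hsep : (f.map (Int.castRingHom ℚ)).Separable)
    (hgal : 12 ∣ Nat.card (f.map (Int.castRingHom ℚ)).Gal)
    (hreal : ((f.map (Int.castRingHom ℝ)).roots).card = 4) : 12 ∣ Nat.card (G f) := by
  have hq := isSepQuartic_of_hyp hdeg hsep
  haveI := isGalois_M hq
  set p : ℚ[X] := f.map (Int.castRingHom ℚ) with hp
  set L := p.SplittingField
  -- (1) `#Gal(p) = [L : ℚ] ≥ 12`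
  have hL : Nat.card p.Gal = Module.finrank ℚ L := Gal.card_of_separable hsep
  have hL12 : 12 ≤ Module.finrank ℚ L := by
    rw [← hL]; exact Nat.le_of_dvd Nat.card_pos hgal
  -- (2) `p` splits in `M`, giving `φ : L →ₐ[ℚ] M`
  have hsplitM : (p.map (algebraMap ℚ (M f))).Splits := by
    have : p.map (algebraMap ℚ (M f)) = (fK f).map (algebraMap K (M f)) := by
      show (f.map (Int.castRingHom ℚ)).map (algebraMap ℚ (M f)) =
        (f.map (algebraMap ℤ K)).map (algebraMap K (M f))
      rw [Polynomial.map_map, Polynomial.map_map]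
      exact congrArg (Polynomial.map · f) (RingHom.ext_int _ _)
    rw [this]; exact SplittingField.splits (fK f)
  let φ : L →ₐ[ℚ] M f := SplittingField.lift p hsplitM
  let L' : IntermediateField ℚ (M f) := φ.fieldRange
  have hL' : Module.finrank ℚ L' = Module.finrank ℚ L :=
    (AlgEquiv.ofInjectiveField φ).toLinearEquiv.finrank_eq.symm
  -- (3) `p` splits over `ℝ` (four real roots), giving `ψ : L →ₐ[ℚ] ℝ`; hence `ω ∉ L'`
  have hsplitR : (p.map (algebraMap ℚ ℝ)).Splits := by
    rw [splits_iff_card_roots]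
    have h1 : p.map (algebraMap ℚ ℝ) = f.map (Int.castRingHom ℝ) := by
      rw [hp, Polynomial.map_map]
      exact congrArg (Polynomial.map · f) (RingHom.ext_int _ _)
    rw [h1, hreal, natDegree_map_eq_of_injective (Int.castRingHom ℝ).injective_int, hdeg]
  let ψ : L →ₐ[ℚ] ℝ := SplittingField.lift p hsplitR
  obtain ⟨z, hz⟩ := exists_omega_M f
  have hzL' : z ∉ L' := by
    rintro ⟨x, rfl⟩
    have hx : x ^ 2 + x + 1 = 0 := by
      apply φ.toRingHom.injective
      simpa using hz
    have := congrArg ψ hx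
    simp only [map_add, map_pow, map_one, map_zero] at this
    exact real_sq_add_self_add_one_ne_zero _ this
  -- (4) `[M : L'] ≥ 2`
  have hML' : 2 ≤ Module.finrank L' (M f) := by
    have hli : LinearIndependent L' ![(1 : M f), z] := by
      refine LinearIndependent.pair_iff.mpr fun s t hst => ?_
      by_contra hne
      have ht : t ≠ 0 := by
        intro ht; apply hne
        simp only [ht, zero_smul, add_zero, smul_eq_zero, one_ne_zero, or_false] at hst
        exact ⟨hst, ht⟩
      apply hzL'
      have : z = -((t : M f)⁻¹ * s) := by
        have hst' : (s : M f) * 1 + (t : M f) * z = 0 := by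
          simpa [IntermediateField.smul_def] using hst
        have htM : (t : M f) ≠ 0 := by exact_mod_cast ht
        field_simp
        linear_combination hst'
      rw [this]
      exact neg_mem (mul_mem (inv_mem t.2) s.2)
    simpa using hli.fintype_card_le_finrank
  -- (5) `[M : ℚ] = 2 [M : K] = [L' : ℚ] [M : L']`
  have htowerK := Module.finrank_mul_finrank ℚ K (M f)
  have htowerL := Module.finrank_mul_finrank ℚ L' (M f)
  -- `[K : ℚ] = 2` (tree lemma; Mathlib's cyclotomic instance is stated for `CyclotomicField.instAlgebra`,
  -- which agrees definitionally with the canonical `ℚ`-algebra structure)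
  haveI : IsCyclotomicExtension {3} ℚ (CyclotomicField 3 ℚ) := CyclotomicField.isCyclotomicExtension 3 ℚ
  rw [Literature.NumberTheory.GaloisRepresentations.finrank_eq_two_of_isCyclotomicExtension_three (K := K)]
    at htowerK
  have hG : Nat.card (G f) = Module.finrank K (M f) := IsGalois.card_aut_eq_finrank K (M f)
  have h24 := card_G_dvd hq
  rw [hG] at h24 ⊢
  -- `[M : K] ≥ [L : ℚ] ≥ 12` and `[M : K] ∣ 24`
  have hge : Module.finrank ℚ L ≤ Module.finrank K (M f) := by
    rw [← hL']; nlinarith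
  have hpos : 0 < Module.finrank K (M f) := Module.finrank_pos
  obtain ⟨c, hc⟩ := h24
  have hc' : c ∣ 24 := Dvd.intro_left _ hc.symm
  have : c ≤ 2 := by
    by_contra hlt
    rw [not_le] at hlt
    have : 3 * Module.finrank K (M f) ≤ 24 := by nlinarith
    omega
  interval_cases c <;> omega

end Summit.Langlands.Langlands.Theorems.ResidualAutomorphyEven
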